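import Summits.QuantumFields.BalabanUV.Beta.GAN24.ChargeStepSym
import Summits.QuantumFields.BalabanUV.Beta.GAN24.WSlotFirstDiff

/-!
# `BalabanUV.Beta.GAN24.FirstDiffSymCharge` — binder row G-an2-4 / (CONV-C), W-slot road «W3» (gan24-p1-g5 `SKELETON-W3.md` v1.0.2 §8.3 ∕ (N-F4d); END #2
# `WSlotT2OfPieces.t2Drift_of_rows` p213240): **THE PIN HALF OF ROW W3-F4d IN THE BOND-SYMMETRISED ZERO-MODE CURRENCY `ZfreeSym`** — the symmetrised ff charge
# of the first difference `D₀ = T♮₁ − T♮₀` is `Sym Zb₀ + (cE₂·Lc^{−(d+5)} − 1)·Sym Z₀`, hence VANISHES at the exact pin `cE₂ = +Lc^{d+5}` given ROW W3-F2a at `m = 0`,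
# FOR EVERY colour tensor `Tc` (no bond-symmetry of `Z₄(Tc)` needed)

NOT IN PRINT; OUR PROOF ([folklore] bookkeeping over leaf-18's `ChargeStepSym.zmode_succ_eq` (p213920: the linear part acts on the ff charge by `λ₀·Sym_bond`),
leaf-07's `WSlotFirstDiff.zmode_sub` ∕ `shape_pair` (p211996), leaf-19's `T2SlotCovariance.T2diff_translate` (p212792); 0 cited facts, 0 `def`, 0 `def … : Prop`,
0 sorry).  CONTEXT.  With the `Zfree` of record (ref2 r57: covariance ∧ CELL charge `= 0`) ROW W3-F4d's `hZ0` is FALSE at `Tc := w22 N` given F2a₀, cE₂ ≠ 0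
(leaf-18-g17's `WilsonQuarticChargeOffDiag.not_hZ0_of_hZb0_w22` p214167: the bond-ANTISYMMETRIC part of `Z₀` survives in `Z(D₀)` whatever the pin).  ROW W3-F3b
(T-irr) holds under the WEAKER `ZfreeSym` (leaf-12's `TransportIrrelevantSym.hTirr_three_symZ_slot` p213864: the first transport step kills antisymmetric charges), and
the ENDs are PARAMETRIC in `Zfree`; with `Zfree := ZfreeSym` the `hZ0` slot of END #2 asks only for the SYMMETRISED charge of `D₀` — which this module computes
and shows to vanish exactly at the pin.  So at `Zfree := ZfreeSym` END #2 has jointly satisfiable zero-mode hypotheses at `Tc := w22 N` (no END re-cut, no change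
of `Tc`): an ALTERNATIVE to leaf-18's repair menu (R1)∕(R2), for the owner∕ref2 to rule on.  ROW W3-F4d's SHAPE half (`hD0`, leaf-07's PART 1) is untouched;
this module is the PIN half in the `ZfreeSym` currency only (one writer: leaf-07's PART 2 targets the record currency; yields to that lineage on request).
HONEST FRAMING (cell contract, verbatim): «discharging `BetaPertH` makes Bałaban's UV stability UNCONDITIONAL — a real constructive-QFT result; it is NOT the
continuum limit and NOT the Clay problem.»  HONEST DEPENDENCY (verbatim): «continuum YM on T⁴ ⇐ BetaPertH ∧ nine spine estimates (0/9 proved); BetaPertH ⇐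
(D1) ∧ (D4) ∧ CAP+tail; G-an2-4 gates asym, D1 and NE2/3/4.»  Conditional on ROW W3-F2a at `m = 0` (OPEN, leaf-20∕leaf-06) and on the EXACT pin (an2's (P6),
undischarged; sign `+` per ref2 (w3_amended)); NOTHING of «T2Shape»∕«T2SupRate»∕(hW₂, hW₂all) discharged; NOT «W-slot closed», NEVER «G-an2-4 closed»; NOT
`BetaPertH`, NOT continuum, NOT Clay.

## What is proved (generic `d`, `Lc ≥ 1`, mixed table with `hmix` (shape) and `hmixt` (block covariance); `T♮_j`, `b♮_0`, `D₀` the LITERAL §8.3 texts)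
* `pow_charge_factor` — `Lc^{d+1}·(cE₂·Lc^{2(d+1)})·(½·(Lc^{d+2})⁻⁴)·2 = cE₂·(Lc^{d+5})⁻¹` (the `λ₀` of the swarm).
* **`symZ_firstDiff_eq`** — `Sym Z(D₀)(μ,ν;α,β) = Sym Zb₀(μ,ν;α,β) + (cE₂·(Lc^{d+5})⁻¹ − 1)·Sym Z₀(μ,ν;α,β)` (`Sym Z(X)(μ,ν) := zmode Lc X μ ν ff + zmode Lc X ν μ ff`).
* **`symZ_firstDiff_eq_zero_of_pinEq`** — at `cE₂ = Lc^{d+5}`, `Sym Zb₀ = 0 ⟹ Sym Z(D₀) = 0`, every `Tc`.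
* **`hZ0_symZ_of_pinEq`** — the `hZ0` slot of END #2 with `Zfree := ZfreeSym` (covariance conjunct by `T2diff_translate`), generic `d`, pin `cE₂ = Lc^{d+5}`;
  **`hZ0_symZ_three`** — the same at `d = 3` with ref2's pin text `cE₂ = (Lc:ℝ)^(2*(3+1))` (= `Lc^{3+5}`), F2a₀ in the `ZfreeSym` form; `hZ0_symZ_three_of_cell` —
  F2a₀ in the record cell form `zmode Lc b♮₀ κ κ′ ff = 0`.
Unit `b2b-balaban-gan24-formalise-leaf-12` (G-an2-4 formalisation swarm, leaf prover 12, gen 21; ROW W3-F3b holder), 2026-08-20.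
-/

noncomputable section

open Finset
open scoped BigOperators
open Literature.MathematicalPhysics.QuantumFieldTheory
open Literature.MathematicalPhysics.QuantumFieldTheory.Balaban1983to89
open Literature.MathematicalPhysics.QuantumFieldTheory.Balaban1983to89.Beta
open ExpKernelCalculus (MKer shiftK)
open OneStepResolventKernel (Fib)
open OneStepKernelFamily (KInvStep)
open StepJetData (mfNeg)
open BalabanCompositeJets (LocStencil₂)
open SecondOrderResponse (LocStencilFM W2SymOfK)
open BalabanStepJetsSucc (mmRead)
open BalabanStepW2 (K3OfK Spure M1 M2Of T2Of)
open AveragingMixedJetTables (vh₂S)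
open Summit.QuantumFields.BalabanUV.Beta.HessKerDressedUnits (unitK unitS)
open Summit.QuantumFields.BalabanUV.Beta.SecondOrderUnits (unitM unitS₂ unitM₂)
open Summit.QuantumFields.BalabanUV.Beta.GAN24.CombesThomas (sfStep smStep)
open Summit.QuantumFields.BalabanUV.Beta.GAN24.BiStencilZeroMode (Tab zmode)
open Summit.QuantumFields.BalabanUV.Beta.GAN24.T2SlotCovariance (T2diff_translate)
open Summit.QuantumFields.BalabanUV.Beta.GAN24.WSlotFirstDiff (zmode_sub shape_pair)
open Summit.QuantumFields.BalabanUV.Beta.GAN24.ChargeStepSym (zmode_succ_eq)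

namespace Summit.QuantumFields.BalabanUV.Beta.GAN24.FirstDiffSymCharge

variable {d : ℕ} {Lc : ℕ} [NeZero Lc]

/-- [folklore] **THE CHARGE FACTOR OF ONE STEP AT PERIOD `Lc`**: `Lc^{d+1}·((cE₂·Lc^{2(d+1)})·(½·(Lc^{d+2})⁻⁴))·2 = cE₂·(Lc^{d+5})⁻¹` — the swarm's `λ₀ = +cE₂·Lc^{−(d+5)}`
(the `2` collects the two bond orders of the symmetrised charge). -/
theorem pow_charge_factor (cE₂ : ℝ) :
    ((Lc : ℝ) ^ (d + 1)) * ((cE₂ * (Lc : ℝ) ^ (2 * (d + 1))) * ((1 / 2 : ℝ) * (((Lc : ℝ) ^ (d + 1 + 1))⁻¹) ^ 4)) * 2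
      = cE₂ * ((Lc : ℝ) ^ (d + 5))⁻¹ := by
  have hL : (Lc : ℝ) ≠ 0 := Nat.cast_ne_zero.mpr (NeZero.ne Lc)
  field_simp
  ring

/-- **THE BOND-SYMMETRISED ff CHARGE OF THE FIRST DIFFERENCE** `D₀ = T♮₁ − T♮₀` of an2's normalised Stage-B family (literal §8.3 texts; generic `d`, `Lc ≥ 1`; mixed
table with shape `hmix` and block covariance `hmixt`):
`Sym Z(D₀)(μ,ν;α,β) = Sym Zb₀(μ,ν;α,β) + (cE₂·(Lc^{d+5})⁻¹ − 1)·Sym Z₀(μ,ν;α,β)`, `Sym Z(X)(μ,ν) := zmode Lc X μ ν (inl α)(inl β) + zmode Lc X ν μ (inl α)(inl β)`.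
[folklore] `zmode_sub` (leaf-07) twice, `zmode_succ_eq` (leaf-18) twice at `j = 0`, `N = Lc`, and `pow_charge_factor`. -/
theorem symZ_firstDiff_eq (hLc : 1 ≤ Lc) (cE cVH cΛ cE₂ cB : ℝ) (Tc : Fin 4 → Fin 4 → Fin 4 → Fin 4 → ℝ)
    {mixFF : Tab d} (hmix : ∃ C δ : ℝ, 0 < δ ∧ LocStencilFM Lc mixFF C δ)
    (hmixt : ∀ (κ : Fin (d + 1)) (u : Fin (d + 1) → ℤ) (ρ : Fin (d + 1)) (w t : Fin (d + 1) → ℤ),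
      mixFF κ (u + (Lc : ℤ) • t) ρ (w + t) = shiftK (-((Lc : ℤ) • t)) (mixFF κ u ρ w))
    (μ ν α β : Fin (d + 1)) :
    zmode Lc (fun κ u κ' u' =>
        unitS₂ (sfStep Lc 1) (smStep d Lc 1) (T2Of d Lc cE cVH cΛ cE₂ cB Tc (vh₂S d Lc) mixFF 1) κ u κ' u'
          - unitS₂ (sfStep Lc 0) (smStep d Lc 0) (T2Of d Lc cE cVH cΛ cE₂ cB Tc (vh₂S d Lc) mixFF 0) κ u κ' u') μ ν (Sum.inl α) (Sum.inl β) + zmode Lc (fun κ u κ' u' =>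
        unitS₂ (sfStep Lc 1) (smStep d Lc 1) (T2Of d Lc cE cVH cΛ cE₂ cB Tc (vh₂S d Lc) mixFF 1) κ u κ' u'
          - unitS₂ (sfStep Lc 0) (smStep d Lc 0) (T2Of d Lc cE cVH cΛ cE₂ cB Tc (vh₂S d Lc) mixFF 0) κ u κ' u') ν μ (Sum.inl α) (Sum.inl β)
      = (zmode Lc (fun κ u κ' u' => (cE₂ * (Lc : ℝ) ^ (2 * (d + 1))) • mmRead Lc (K3OfK
            (unitK (sfStep Lc 0) (smStep d Lc 0) (KInvStep (d := d) Lc 0)) Lc (unitS (sfStep Lc 0) (smStep d Lc 0) (Spure d Lc cE cVH cΛ 0))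
            (unitM (sfStep Lc 0) (smStep d Lc 0) (M1 d Lc cΛ 0)) (W2SymOfK (unitK (sfStep Lc 0) (smStep d Lc 0) (KInvStep (d := d) Lc 0)) Lc
            (unitS (sfStep Lc 0) (smStep d Lc 0) (Spure d Lc cE cVH cΛ 0)) (unitM (sfStep Lc 0) (smStep d Lc 0) (M1 d Lc cΛ 0)) 0
            (unitM₂ (sfStep Lc 0) (smStep d Lc 0) (M2Of d Lc mixFF 0))) κ u κ' u') + cB • mfNeg ((vh₂S d Lc) κ u κ' u')) μ ν (Sum.inl α) (Sum.inl β) + zmode Lc (fun κ u κ' u' => (cE₂ * (Lc : ℝ) ^ (2 * (d + 1))) • mmRead Lc (K3OfK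
            (unitK (sfStep Lc 0) (smStep d Lc 0) (KInvStep (d := d) Lc 0)) Lc (unitS (sfStep Lc 0) (smStep d Lc 0) (Spure d Lc cE cVH cΛ 0))
            (unitM (sfStep Lc 0) (smStep d Lc 0) (M1 d Lc cΛ 0)) (W2SymOfK (unitK (sfStep Lc 0) (smStep d Lc 0) (KInvStep (d := d) Lc 0)) Lc
            (unitS (sfStep Lc 0) (smStep d Lc 0) (Spure d Lc cE cVH cΛ 0)) (unitM (sfStep Lc 0) (smStep d Lc 0) (M1 d Lc cΛ 0)) 0
            (unitM₂ (sfStep Lc 0) (smStep d Lc 0) (M2Of d Lc mixFF 0))) κ u κ' u') + cB • mfNeg ((vh₂S d Lc) κ u κ' u')) ν μ (Sum.inl α) (Sum.inl β))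
        + (cE₂ * ((Lc : ℝ) ^ (d + 5))⁻¹ - 1) * (zmode Lc (unitS₂ (sfStep Lc 0) (smStep d Lc 0) (T2Of d Lc cE cVH cΛ cE₂ cB Tc (vh₂S d Lc) mixFF 0)) μ ν (Sum.inl α) (Sum.inl β) + zmode Lc (unitS₂ (sfStep Lc 0) (smStep d Lc 0) (T2Of d Lc cE cVH cΛ cE₂ cB Tc (vh₂S d Lc) mixFF 0)) ν μ (Sum.inl α) (Sum.inl β)) := by
  obtain ⟨C₀, C₁, δ₀, hδ₀, -, -, h₀, h₁⟩ := shape_pair hLc cE cVH cΛ cE₂ cB Tc hmix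
  rw [zmode_sub h₁ h₀ hδ₀ μ ν, zmode_sub h₁ h₀ hδ₀ ν μ,
    zmode_succ_eq hLc Lc cE cVH cΛ cE₂ cB Tc hmix hmixt 0 μ ν α β, zmode_succ_eq hLc Lc cE cVH cΛ cE₂ cB Tc hmix hmixt 0 ν μ α β,
    ← pow_charge_factor (d := d) (Lc := Lc) cE₂]
  ring

/-- **AT THE EXACT PIN `cE₂ = +Lc^{d+5}` THE SYMMETRISED CHARGE OF `D₀` IS THAT OF THE SOURCE `b♮₀`** — hence VANISHES given ROW W3-F2a at `m = 0` in the `ZfreeSym`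
form, FOR EVERY colour tensor `Tc` (the bond-antisymmetric part of `Z₀`, which refutes the record-currency `hZ0` at `Tc := w22 N`, is invisible here). -/
theorem symZ_firstDiff_eq_zero_of_pinEq (hLc : 1 ≤ Lc) (cE cVH cΛ cE₂ cB : ℝ) (Tc : Fin 4 → Fin 4 → Fin 4 → Fin 4 → ℝ)
    {mixFF : Tab d} (hmix : ∃ C δ : ℝ, 0 < δ ∧ LocStencilFM Lc mixFF C δ)
    (hmixt : ∀ (κ : Fin (d + 1)) (u : Fin (d + 1) → ℤ) (ρ : Fin (d + 1)) (w t : Fin (d + 1) → ℤ),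
      mixFF κ (u + (Lc : ℤ) • t) ρ (w + t) = shiftK (-((Lc : ℤ) • t)) (mixFF κ u ρ w))
    (hpinEq : cE₂ = (Lc : ℝ) ^ (d + 5))
    (hZb0 : ∀ μ ν α β : Fin (d + 1), zmode Lc (fun κ u κ' u' => (cE₂ * (Lc : ℝ) ^ (2 * (d + 1))) • mmRead Lc (K3OfK
            (unitK (sfStep Lc 0) (smStep d Lc 0) (KInvStep (d := d) Lc 0)) Lc (unitS (sfStep Lc 0) (smStep d Lc 0) (Spure d Lc cE cVH cΛ 0))
            (unitM (sfStep Lc 0) (smStep d Lc 0) (M1 d Lc cΛ 0)) (W2SymOfK (unitK (sfStep Lc 0) (smStep d Lc 0) (KInvStep (d := d) Lc 0)) Lc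
            (unitS (sfStep Lc 0) (smStep d Lc 0) (Spure d Lc cE cVH cΛ 0)) (unitM (sfStep Lc 0) (smStep d Lc 0) (M1 d Lc cΛ 0)) 0
            (unitM₂ (sfStep Lc 0) (smStep d Lc 0) (M2Of d Lc mixFF 0))) κ u κ' u') + cB • mfNeg ((vh₂S d Lc) κ u κ' u')) μ ν (Sum.inl α) (Sum.inl β) + zmode Lc (fun κ u κ' u' => (cE₂ * (Lc : ℝ) ^ (2 * (d + 1))) • mmRead Lc (K3OfK
            (unitK (sfStep Lc 0) (smStep d Lc 0) (KInvStep (d := d) Lc 0)) Lc (unitS (sfStep Lc 0) (smStep d Lc 0) (Spure d Lc cE cVH cΛ 0))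
            (unitM (sfStep Lc 0) (smStep d Lc 0) (M1 d Lc cΛ 0)) (W2SymOfK (unitK (sfStep Lc 0) (smStep d Lc 0) (KInvStep (d := d) Lc 0)) Lc
            (unitS (sfStep Lc 0) (smStep d Lc 0) (Spure d Lc cE cVH cΛ 0)) (unitM (sfStep Lc 0) (smStep d Lc 0) (M1 d Lc cΛ 0)) 0
            (unitM₂ (sfStep Lc 0) (smStep d Lc 0) (M2Of d Lc mixFF 0))) κ u κ' u') + cB • mfNeg ((vh₂S d Lc) κ u κ' u')) ν μ (Sum.inl α) (Sum.inl β) = 0)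
    (μ ν α β : Fin (d + 1)) :
    zmode Lc (fun κ u κ' u' =>
        unitS₂ (sfStep Lc 1) (smStep d Lc 1) (T2Of d Lc cE cVH cΛ cE₂ cB Tc (vh₂S d Lc) mixFF 1) κ u κ' u'
          - unitS₂ (sfStep Lc 0) (smStep d Lc 0) (T2Of d Lc cE cVH cΛ cE₂ cB Tc (vh₂S d Lc) mixFF 0) κ u κ' u') μ ν (Sum.inl α) (Sum.inl β) + zmode Lc (fun κ u κ' u' =>
        unitS₂ (sfStep Lc 1) (smStep d Lc 1) (T2Of d Lc cE cVH cΛ cE₂ cB Tc (vh₂S d Lc) mixFF 1) κ u κ' u'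
          - unitS₂ (sfStep Lc 0) (smStep d Lc 0) (T2Of d Lc cE cVH cΛ cE₂ cB Tc (vh₂S d Lc) mixFF 0) κ u κ' u') ν μ (Sum.inl α) (Sum.inl β) = 0 := by
  have hL : (Lc : ℝ) ^ (d + 5) ≠ 0 := pow_ne_zero _ (Nat.cast_ne_zero.mpr (NeZero.ne Lc))
  rw [symZ_firstDiff_eq hLc cE cVH cΛ cE₂ cB Tc hmix hmixt μ ν α β, hZb0, hpinEq, mul_inv_cancel₀ hL, sub_self, zero_mul, add_zero]

/-- **THE `hZ0` SLOT OF END #2 WITH `Zfree := ZfreeSym`, generic `d`**: under the exact pin `cE₂ = Lc^{d+5}` and ROW W3-F2a at `m = 0` (`ZfreeSym` form, only its charge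
conjunct is used), `ZfreeSym (D₀)` = (joint `Lc`-covariance of `D₀` — leaf-19's `T2diff_translate`) ∧ (`Sym Z(D₀) = 0`). -/
theorem hZ0_symZ_of_pinEq (hLc : 1 ≤ Lc) (cE cVH cΛ cE₂ cB : ℝ) (Tc : Fin 4 → Fin 4 → Fin 4 → Fin 4 → ℝ)
    {mixFF : Tab d} (hmix : ∃ C δ : ℝ, 0 < δ ∧ LocStencilFM Lc mixFF C δ)
    (hmixt : ∀ (κ : Fin (d + 1)) (u : Fin (d + 1) → ℤ) (ρ : Fin (d + 1)) (w t : Fin (d + 1) → ℤ),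
      mixFF κ (u + (Lc : ℤ) • t) ρ (w + t) = shiftK (-((Lc : ℤ) • t)) (mixFF κ u ρ w))
    (hpinEq : cE₂ = (Lc : ℝ) ^ (d + 5))
    (hZb0 : ∀ μ ν α β : Fin (d + 1), zmode Lc (fun κ u κ' u' => (cE₂ * (Lc : ℝ) ^ (2 * (d + 1))) • mmRead Lc (K3OfK
            (unitK (sfStep Lc 0) (smStep d Lc 0) (KInvStep (d := d) Lc 0)) Lc (unitS (sfStep Lc 0) (smStep d Lc 0) (Spure d Lc cE cVH cΛ 0))
            (unitM (sfStep Lc 0) (smStep d Lc 0) (M1 d Lc cΛ 0)) (W2SymOfK (unitK (sfStep Lc 0) (smStep d Lc 0) (KInvStep (d := d) Lc 0)) Lc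
            (unitS (sfStep Lc 0) (smStep d Lc 0) (Spure d Lc cE cVH cΛ 0)) (unitM (sfStep Lc 0) (smStep d Lc 0) (M1 d Lc cΛ 0)) 0
            (unitM₂ (sfStep Lc 0) (smStep d Lc 0) (M2Of d Lc mixFF 0))) κ u κ' u') + cB • mfNeg ((vh₂S d Lc) κ u κ' u')) μ ν (Sum.inl α) (Sum.inl β) + zmode Lc (fun κ u κ' u' => (cE₂ * (Lc : ℝ) ^ (2 * (d + 1))) • mmRead Lc (K3OfK
            (unitK (sfStep Lc 0) (smStep d Lc 0) (KInvStep (d := d) Lc 0)) Lc (unitS (sfStep Lc 0) (smStep d Lc 0) (Spure d Lc cE cVH cΛ 0))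
            (unitM (sfStep Lc 0) (smStep d Lc 0) (M1 d Lc cΛ 0)) (W2SymOfK (unitK (sfStep Lc 0) (smStep d Lc 0) (KInvStep (d := d) Lc 0)) Lc
            (unitS (sfStep Lc 0) (smStep d Lc 0) (Spure d Lc cE cVH cΛ 0)) (unitM (sfStep Lc 0) (smStep d Lc 0) (M1 d Lc cΛ 0)) 0
            (unitM₂ (sfStep Lc 0) (smStep d Lc 0) (M2Of d Lc mixFF 0))) κ u κ' u') + cB • mfNeg ((vh₂S d Lc) κ u κ' u')) ν μ (Sum.inl α) (Sum.inl β) = 0) :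
    (∀ κ u κ' u' t, (fun κ u κ' u' =>
        unitS₂ (sfStep Lc 1) (smStep d Lc 1) (T2Of d Lc cE cVH cΛ cE₂ cB Tc (vh₂S d Lc) mixFF 1) κ u κ' u'
          - unitS₂ (sfStep Lc 0) (smStep d Lc 0) (T2Of d Lc cE cVH cΛ cE₂ cB Tc (vh₂S d Lc) mixFF 0) κ u κ' u') κ (u + (Lc : ℤ) • t) κ' (u' + (Lc : ℤ) • t) = shiftK (-((Lc : ℤ) • t)) ((fun κ u κ' u' =>
        unitS₂ (sfStep Lc 1) (smStep d Lc 1) (T2Of d Lc cE cVH cΛ cE₂ cB Tc (vh₂S d Lc) mixFF 1) κ u κ' u'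
          - unitS₂ (sfStep Lc 0) (smStep d Lc 0) (T2Of d Lc cE cVH cΛ cE₂ cB Tc (vh₂S d Lc) mixFF 0) κ u κ' u') κ u κ' u')) ∧
      (∀ μ ν α β : Fin (d + 1), zmode Lc (fun κ u κ' u' =>
        unitS₂ (sfStep Lc 1) (smStep d Lc 1) (T2Of d Lc cE cVH cΛ cE₂ cB Tc (vh₂S d Lc) mixFF 1) κ u κ' u'
          - unitS₂ (sfStep Lc 0) (smStep d Lc 0) (T2Of d Lc cE cVH cΛ cE₂ cB Tc (vh₂S d Lc) mixFF 0) κ u κ' u') μ ν (Sum.inl α) (Sum.inl β) + zmode Lc (fun κ u κ' u' =>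
        unitS₂ (sfStep Lc 1) (smStep d Lc 1) (T2Of d Lc cE cVH cΛ cE₂ cB Tc (vh₂S d Lc) mixFF 1) κ u κ' u'
          - unitS₂ (sfStep Lc 0) (smStep d Lc 0) (T2Of d Lc cE cVH cΛ cE₂ cB Tc (vh₂S d Lc) mixFF 0) κ u κ' u') ν μ (Sum.inl α) (Sum.inl β) = 0) :=
  ⟨fun κ u κ' u' t => T2diff_translate hLc cE cVH cΛ cE₂ cB Tc hmixt 0 κ u κ' u' t,
    fun μ ν α β => symZ_firstDiff_eq_zero_of_pinEq hLc cE cVH cΛ cE₂ cB Tc hmix hmixt hpinEq hZb0 μ ν α β⟩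

/-! ## `d = 3`: ref2's pin text `cE₂ = (Lc:ℝ)^(2*(3+1))` (`= Lc^{3+5}`) -/

/-- **ROW W3-F4d's PIN HALF AT `d = 3` IN THE `ZfreeSym` CURRENCY**: `Lc ≥ 1`, mixed table with `hmix`∕`hmixt`, the EXACT pin `hpinEq : cE₂ = (Lc:ℝ)^(2*(3+1))`
(ref2 (w3_amended): `+Lc⁸`), ROW W3-F2a at `m = 0` in the `ZfreeSym` form (only its charge conjunct) ⟹ `ZfreeSym (D₀)` — the `hZ0` binder of
`WSlotT2OfPieces.t2Drift_of_rows (d := 3)` ∕ `TransportRows.rate_three_of_rows_F3b` at `Zfree := ZfreeSym`, for EVERY `Tc`. -/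
theorem hZ0_symZ_three {Lc : ℕ} [NeZero Lc] (hLc : 1 ≤ Lc) (cE cVH cΛ cE₂ cB : ℝ) (Tc : Fin 4 → Fin 4 → Fin 4 → Fin 4 → ℝ)
    {mixFF : Tab 3} (hmix : ∃ C δ : ℝ, 0 < δ ∧ LocStencilFM Lc mixFF C δ)
    (hmixt : ∀ (κ : Fin (3 + 1)) (u : Fin (3 + 1) → ℤ) (ρ : Fin (3 + 1)) (w t : Fin (3 + 1) → ℤ),
      mixFF κ (u + (Lc : ℤ) • t) ρ (w + t) = shiftK (-((Lc : ℤ) • t)) (mixFF κ u ρ w))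
    (hpinEq : cE₂ = (Lc : ℝ) ^ (2 * (3 + 1)))
    (hZb0 : ∀ μ ν α β : Fin (3 + 1), zmode Lc (fun κ u κ' u' => (cE₂ * (Lc : ℝ) ^ (2 * (3 + 1))) • mmRead Lc (K3OfK
            (unitK (sfStep Lc 0) (smStep 3 Lc 0) (KInvStep (d := 3) Lc 0)) Lc (unitS (sfStep Lc 0) (smStep 3 Lc 0) (Spure 3 Lc cE cVH cΛ 0))
            (unitM (sfStep Lc 0) (smStep 3 Lc 0) (M1 3 Lc cΛ 0)) (W2SymOfK (unitK (sfStep Lc 0) (smStep 3 Lc 0) (KInvStep (d := 3) Lc 0)) Lc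
            (unitS (sfStep Lc 0) (smStep 3 Lc 0) (Spure 3 Lc cE cVH cΛ 0)) (unitM (sfStep Lc 0) (smStep 3 Lc 0) (M1 3 Lc cΛ 0)) 0
            (unitM₂ (sfStep Lc 0) (smStep 3 Lc 0) (M2Of 3 Lc mixFF 0))) κ u κ' u') + cB • mfNeg ((vh₂S 3 Lc) κ u κ' u')) μ ν (Sum.inl α) (Sum.inl β) + zmode Lc (fun κ u κ' u' => (cE₂ * (Lc : ℝ) ^ (2 * (3 + 1))) • mmRead Lc (K3OfK
            (unitK (sfStep Lc 0) (smStep 3 Lc 0) (KInvStep (d := 3) Lc 0)) Lc (unitS (sfStep Lc 0) (smStep 3 Lc 0) (Spure 3 Lc cE cVH cΛ 0))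
            (unitM (sfStep Lc 0) (smStep 3 Lc 0) (M1 3 Lc cΛ 0)) (W2SymOfK (unitK (sfStep Lc 0) (smStep 3 Lc 0) (KInvStep (d := 3) Lc 0)) Lc
            (unitS (sfStep Lc 0) (smStep 3 Lc 0) (Spure 3 Lc cE cVH cΛ 0)) (unitM (sfStep Lc 0) (smStep 3 Lc 0) (M1 3 Lc cΛ 0)) 0
            (unitM₂ (sfStep Lc 0) (smStep 3 Lc 0) (M2Of 3 Lc mixFF 0))) κ u κ' u') + cB • mfNeg ((vh₂S 3 Lc) κ u κ' u')) ν μ (Sum.inl α) (Sum.inl β) = 0) :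
    (∀ κ u κ' u' t, (fun κ u κ' u' =>
        unitS₂ (sfStep Lc 1) (smStep 3 Lc 1) (T2Of 3 Lc cE cVH cΛ cE₂ cB Tc (vh₂S 3 Lc) mixFF 1) κ u κ' u'
          - unitS₂ (sfStep Lc 0) (smStep 3 Lc 0) (T2Of 3 Lc cE cVH cΛ cE₂ cB Tc (vh₂S 3 Lc) mixFF 0) κ u κ' u') κ (u + (Lc : ℤ) • t) κ' (u' + (Lc : ℤ) • t) = shiftK (-((Lc : ℤ) • t)) ((fun κ u κ' u' =>
        unitS₂ (sfStep Lc 1) (smStep 3 Lc 1) (T2Of 3 Lc cE cVH cΛ cE₂ cB Tc (vh₂S 3 Lc) mixFF 1) κ u κ' u'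
          - unitS₂ (sfStep Lc 0) (smStep 3 Lc 0) (T2Of 3 Lc cE cVH cΛ cE₂ cB Tc (vh₂S 3 Lc) mixFF 0) κ u κ' u') κ u κ' u')) ∧
      (∀ μ ν α β : Fin (3 + 1), zmode Lc (fun κ u κ' u' =>
        unitS₂ (sfStep Lc 1) (smStep 3 Lc 1) (T2Of 3 Lc cE cVH cΛ cE₂ cB Tc (vh₂S 3 Lc) mixFF 1) κ u κ' u'
          - unitS₂ (sfStep Lc 0) (smStep 3 Lc 0) (T2Of 3 Lc cE cVH cΛ cE₂ cB Tc (vh₂S 3 Lc) mixFF 0) κ u κ' u') μ ν (Sum.inl α) (Sum.inl β) + zmode Lc (fun κ u κ' u' =>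
        unitS₂ (sfStep Lc 1) (smStep 3 Lc 1) (T2Of 3 Lc cE cVH cΛ cE₂ cB Tc (vh₂S 3 Lc) mixFF 1) κ u κ' u'
          - unitS₂ (sfStep Lc 0) (smStep 3 Lc 0) (T2Of 3 Lc cE cVH cΛ cE₂ cB Tc (vh₂S 3 Lc) mixFF 0) κ u κ' u') ν μ (Sum.inl α) (Sum.inl β) = 0) :=
  hZ0_symZ_of_pinEq (d := 3) hLc cE cVH cΛ cE₂ cB Tc hmix hmixt (by rw [hpinEq]) hZb0

/-- **THE SAME FED BY ROW W3-F2a at `m = 0` IN THE RECORD CELL FORM** `∀ μ ν α β, zmode Lc b♮₀ μ ν (inl α) (inl β) = 0` (`d = 3`). -/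
theorem hZ0_symZ_three_of_cell {Lc : ℕ} [NeZero Lc] (hLc : 1 ≤ Lc) (cE cVH cΛ cE₂ cB : ℝ) (Tc : Fin 4 → Fin 4 → Fin 4 → Fin 4 → ℝ)
    {mixFF : Tab 3} (hmix : ∃ C δ : ℝ, 0 < δ ∧ LocStencilFM Lc mixFF C δ)
    (hmixt : ∀ (κ : Fin (3 + 1)) (u : Fin (3 + 1) → ℤ) (ρ : Fin (3 + 1)) (w t : Fin (3 + 1) → ℤ),
      mixFF κ (u + (Lc : ℤ) • t) ρ (w + t) = shiftK (-((Lc : ℤ) • t)) (mixFF κ u ρ w))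
    (hpinEq : cE₂ = (Lc : ℝ) ^ (2 * (3 + 1)))
    (hZb0 : ∀ μ ν α β : Fin (3 + 1), zmode Lc (fun κ u κ' u' => (cE₂ * (Lc : ℝ) ^ (2 * (3 + 1))) • mmRead Lc (K3OfK
            (unitK (sfStep Lc 0) (smStep 3 Lc 0) (KInvStep (d := 3) Lc 0)) Lc (unitS (sfStep Lc 0) (smStep 3 Lc 0) (Spure 3 Lc cE cVH cΛ 0))
            (unitM (sfStep Lc 0) (smStep 3 Lc 0) (M1 3 Lc cΛ 0)) (W2SymOfK (unitK (sfStep Lc 0) (smStep 3 Lc 0) (KInvStep (d := 3) Lc 0)) Lc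
            (unitS (sfStep Lc 0) (smStep 3 Lc 0) (Spure 3 Lc cE cVH cΛ 0)) (unitM (sfStep Lc 0) (smStep 3 Lc 0) (M1 3 Lc cΛ 0)) 0
            (unitM₂ (sfStep Lc 0) (smStep 3 Lc 0) (M2Of 3 Lc mixFF 0))) κ u κ' u') + cB • mfNeg ((vh₂S 3 Lc) κ u κ' u')) μ ν (Sum.inl α) (Sum.inl β) = 0) :
    (∀ κ u κ' u' t, (fun κ u κ' u' =>
        unitS₂ (sfStep Lc 1) (smStep 3 Lc 1) (T2Of 3 Lc cE cVH cΛ cE₂ cB Tc (vh₂S 3 Lc) mixFF 1) κ u κ' u'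
          - unitS₂ (sfStep Lc 0) (smStep 3 Lc 0) (T2Of 3 Lc cE cVH cΛ cE₂ cB Tc (vh₂S 3 Lc) mixFF 0) κ u κ' u') κ (u + (Lc : ℤ) • t) κ' (u' + (Lc : ℤ) • t) = shiftK (-((Lc : ℤ) • t)) ((fun κ u κ' u' =>
        unitS₂ (sfStep Lc 1) (smStep 3 Lc 1) (T2Of 3 Lc cE cVH cΛ cE₂ cB Tc (vh₂S 3 Lc) mixFF 1) κ u κ' u'
          - unitS₂ (sfStep Lc 0) (smStep 3 Lc 0) (T2Of 3 Lc cE cVH cΛ cE₂ cB Tc (vh₂S 3 Lc) mixFF 0) κ u κ' u') κ u κ' u')) ∧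
      (∀ μ ν α β : Fin (3 + 1), zmode Lc (fun κ u κ' u' =>
        unitS₂ (sfStep Lc 1) (smStep 3 Lc 1) (T2Of 3 Lc cE cVH cΛ cE₂ cB Tc (vh₂S 3 Lc) mixFF 1) κ u κ' u'
          - unitS₂ (sfStep Lc 0) (smStep 3 Lc 0) (T2Of 3 Lc cE cVH cΛ cE₂ cB Tc (vh₂S 3 Lc) mixFF 0) κ u κ' u') μ ν (Sum.inl α) (Sum.inl β) + zmode Lc (fun κ u κ' u' =>
        unitS₂ (sfStep Lc 1) (smStep 3 Lc 1) (T2Of 3 Lc cE cVH cΛ cE₂ cB Tc (vh₂S 3 Lc) mixFF 1) κ u κ' u'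
          - unitS₂ (sfStep Lc 0) (smStep 3 Lc 0) (T2Of 3 Lc cE cVH cΛ cE₂ cB Tc (vh₂S 3 Lc) mixFF 0) κ u κ' u') ν μ (Sum.inl α) (Sum.inl β) = 0) :=
  hZ0_symZ_three hLc cE cVH cΛ cE₂ cB Tc hmix hmixt hpinEq (fun μ ν α β => by rw [hZb0, hZb0, add_zero])

end Summit.QuantumFields.BalabanUV.Beta.GAN24.FirstDiffSymCharge

end
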